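import Summits.PneNP.PneNP.Theorems.OneSliceSingleThresholdGnpTVSprinkle
import Literature.Computability.Complexity.RossmanMonotoneCliqueGraphs

/-!
# The dose is invisible beyond the window: `TV(G(n, p⁻ ⊕ n^{-σ}), G(n, p⁻)) → 0` for `σ > 1 + (1+ε)/(k-1)`

Route `OneSlice`, crux `Summit.PneNP.PneNP.Theses.OneSlice.SingleThreshold` (stmt-PneNP-2833), line
`two-round-exposure`: the registered stub `stub_doseInvisibleBeyondWindow` (stub J), the subcritical
companion of `stub_gnpTVSprinkle` (`OneSliceSingleThresholdGnpTVSprinkle.lean`, stub G).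

**What.** For `k ≥ 3`, `ε ≥ 0` and `σ > 1 + (1+ε)/(k-1)`, with the subcritical background density
`p = p⁻ = pMinus k ε n = n^{-2(1+ε)/(k-1)}`, the dose density `ρ = n^{-σ}` and `p ⊕ ρ = p + ρ − pρ`
(the law of `G(n,p) ∪ G(n,ρ)`), the total variation distance between the two product Bernoulli
measures on the edge vectors of `K_n` vanishes: `Σ_z |w_{p ⊕ ρ}(z) − w_p(z)| → 0`.

**How (χ² of product measures, verbatim the computation of stub G).** For `0 < p < 1`:
`(Σ_z |w_{p⊕ρ}(z) − w_p(z)|)² ≤ (1 + ρ²(1−p)/p)^{C(n,2)} − 1` (`tv_sq_le_chiSq`,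
`chiSq_base_sprinkle`) `≤ 2 C(n,2) ρ²(1−p)/p` once `C(n,2) ρ²(1−p)/p ≤ 1`
(`one_add_pow_sub_one_le_two_mul`), and `C(n,2) ρ²(1−p)/p ≤ (n²/2) n^{-2σ} n^{2(1+ε)/(k-1)} = n^{-γ}/2`
with `γ = 2σ − 2 − 2(1+ε)/(k−1) > 0` exactly when `σ > 1 + (1+ε)/(k−1)`; so eventually `TV² ≤ n^{-γ}`,
`TV ≤ √(n^{-γ}) → 0`.

## References

* S. Janson, T. Łuczak, A. Ruciński, *Random Graphs*, Wiley (2000), §1.6 (asymptotic equivalence of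
  `G(n,p)` and `G(n,p')` when `|p − p'| C(n,2) ≪ √(C(n,2) p)`), folklore.
-/

noncomputable section

set_option linter.dupNamespace false

open Finset Filter

open scoped Classical Topology

namespace Summit.PneNP.PneNP.Theorems.SingleThreshold

open Literature.Computability.Complexity
open Summit.PneNP.PneNP.Theorems.SingleThreshold.Negative (Edges)

/-! ### The sprinkle at the subcritical density `p⁻` -/

/-- **Stub J — the dose is invisible beyond the window.** For `k ≥ 3`, `ε ≥ 0` and
`σ > 1 + (1+ε)/(k−1)`: `TV(G(n, p⁻ ⊕ n^{-σ}), G(n, p⁻)) = Σ_z |w_{p⊕ρ}(z) − w_p(z)| → 0`,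
`p = p⁻ = n^{-2(1+ε)/(k-1)}` (`pMinus k ε n`), `ρ = n^{-σ}`, `p ⊕ ρ = p + ρ − pρ`. Proof:
`TV² ≤ χ² = (1 + ρ²(1−p)/p)^{C(n,2)} − 1` (`tv_sq_le_chiSq`, `chiSq_base_sprinkle`)
`≤ 2 C(n,2) ρ²(1−p)/p ≤ n^{2 − 2σ + 2(1+ε)/(k−1)} → 0` (`one_add_pow_sub_one_le_two_mul`), the exponent
being negative iff `σ > 1 + (1+ε)/(k−1)`, i.e. iff the expected number `≈ n^{2−σ}/2` of dosed edges is
`≪ √(C(n,2) p) ≈ n^{1−(1+ε)/(k−1)}`, the standard deviation of the edge count of `G(n,p)`.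
[folklore; cf. Janson–Łuczak–Ruciński, Random Graphs (2000), §1.6 (asymptotic equivalence of `G(n,p)`
and `G(n,p')`)] -/
theorem stub_doseInvisibleBeyondWindow :
    ∀ k : ℕ, 3 ≤ k → ∀ ε : ℝ, 0 ≤ ε → ∀ σ : ℝ, 1 + (1 + ε) / ((k : ℝ) - 1) < σ →
      Tendsto (fun n : ℕ => ∑ z : Edges n → Bool,
        |gnpWeight n (pMinus k ε n + (n : ℝ) ^ (-σ) - pMinus k ε n * (n : ℝ) ^ (-σ)) z -
          gnpWeight n (pMinus k ε n) z|) atTop (𝓝 0) := by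
  intro k hk ε hε σ hσ
  have hK : (3 : ℝ) ≤ k := by exact_mod_cast hk
  have hK1 : 0 < (k : ℝ) - 1 := by linarith
  -- `p = n^{-β}` with `β = 2(1+ε)/(k-1)`; the gain exponent `γ = 2σ - 2 - β > 0`
  set β : ℝ := 2 * (1 + ε) / ((k : ℝ) - 1) with hβ
  have hβ0 : 0 < β := div_pos (by linarith) hK1
  set γ : ℝ := 2 * σ - 2 - β with hγ
  have hγ0 : 0 < γ := by
    have h1 : (1 + ε) / ((k : ℝ) - 1) = β / 2 := by rw [hβ]; ring
    rw [h1] at hσ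
    rw [hγ]
    linarith
  -- the pointwise bound `TV² ≤ n^{-γ}` for `n ≥ 2`
  have hbound : ∀ n : ℕ, 2 ≤ n →
      (∑ z : Edges n → Bool,
        |gnpWeight n (pMinus k ε n + (n : ℝ) ^ (-σ) - pMinus k ε n * (n : ℝ) ^ (-σ)) z
          - gnpWeight n (pMinus k ε n) z|) ^ 2 ≤ (n : ℝ) ^ (-γ) := by
    intro n hn
    have hn0 : (0 : ℝ) < n := by exact_mod_cast (by omega : 0 < n)
    have hn1 : (1 : ℝ) < n := by exact_mod_cast (by omega : 1 < n)
    set p : ℝ := pMinus k ε n with hp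
    set ρ : ℝ := (n : ℝ) ^ (-σ) with hρ
    have hpβ : p = (n : ℝ) ^ (-β) := by rw [hp, pMinus, hβ, neg_div]
    have hp0 : 0 < p := by rw [hpβ]; exact Real.rpow_pos_of_pos hn0 _
    have hp1 : p < 1 := by
      rw [hpβ]; exact Real.rpow_lt_one_of_one_lt_of_neg hn1 (by linarith)
    have hρ0 : 0 ≤ ρ := Real.rpow_nonneg hn0.le _
    -- χ² bound
    have h1 := tv_sq_le_chiSq (n := n) hp0 hp1 (p + ρ - p * ρ)
    rw [chiSq_base_sprinkle ρ hp0.ne' (by linarith)] at h1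
    set a : ℝ := ρ ^ 2 * (1 - p) / p with ha
    have ha0 : 0 ≤ a := div_nonneg (mul_nonneg (sq_nonneg _) (by linarith)) hp0.le
    -- `C(n,2) · a ≤ n^{-γ}/2`
    have hρ2 : ρ ^ 2 = (n : ℝ) ^ (-(2 * σ)) := by
      rw [hρ, ← Real.rpow_two, ← Real.rpow_mul hn0.le]
      congr 1
      ring
    have hpinv : p⁻¹ = (n : ℝ) ^ β := by rw [hpβ, Real.rpow_neg hn0.le, inv_inv]
    have key : (n : ℝ) ^ 2 / 2 * (ρ ^ 2 / p) = (n : ℝ) ^ (-γ) / 2 := by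
      rw [div_eq_mul_inv (ρ ^ 2) p, hρ2, hpinv, ← Real.rpow_two, ← Real.rpow_add hn0,
        div_mul_eq_mul_div, ← Real.rpow_add hn0,
        show (2 : ℝ) + (-(2 * σ) + β) = -γ by rw [hγ]; ring]
    have hN : (n.choose 2 : ℝ) ≤ (n : ℝ) ^ 2 / 2 := by
      rw [Nat.cast_choose_two]
      nlinarith
    have haρ : a ≤ ρ ^ 2 / p := by
      rw [ha]
      refine div_le_div_of_nonneg_right ?_ hp0.le
      nlinarith [sq_nonneg ρ]
    have hNa : (n.choose 2 : ℝ) * a ≤ (n : ℝ) ^ (-γ) / 2 :=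
      calc (n.choose 2 : ℝ) * a ≤ (n : ℝ) ^ 2 / 2 * (ρ ^ 2 / p) :=
            mul_le_mul hN haρ ha0 (by positivity)
        _ = (n : ℝ) ^ (-γ) / 2 := key
    have hγle : (n : ℝ) ^ (-γ) ≤ 1 := Real.rpow_le_one_of_one_le_of_nonpos hn1.le (by linarith)
    have h2 := one_add_pow_sub_one_le_two_mul ha0 (by linarith : (n.choose 2 : ℝ) * a ≤ 1)
    linarith
  -- squeeze: `0 ≤ TV ≤ √(n^{-γ}) → 0`
  have hlim : Tendsto (fun n : ℕ => Real.sqrt ((n : ℝ) ^ (-γ))) atTop (𝓝 0) := by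
    have h := ((tendsto_rpow_neg_atTop hγ0).comp tendsto_natCast_atTop_atTop).sqrt
    rw [Real.sqrt_zero] at h
    exact h
  refine squeeze_zero' (Eventually.of_forall fun n => sum_nonneg fun z _ => abs_nonneg _)
    ((eventually_ge_atTop 2).mono fun n hn => ?_) hlim
  exact (le_abs_self _).trans (Real.abs_le_sqrt (hbound n hn))

end Summit.PneNP.PneNP.Theorems.SingleThreshold

end
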